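import Summits.KontsevichZagierPeriods.KontsevichZagierPeriods.Theorems.HermiteRigidityReductionRigidityDupJoinKernelGen

/-!
# `ReductionRigidity` (stmt-KontsevichZagierPeriods-3407), line `Sketch`: THE DUPLICATION TOWER OF HEIGHT TWO
# (`stub_dupTowerTwoKernelGen`) — the five-level island `{N, −N, N², −N², N⁴}` in every weight, rigidity inlined

Route `KontsevichZagierPeriods/HermiteRigidity`, crux `ReductionRigidity` (stmt-3407, summit-equivalent; skeleton
`Cruxes/ReductionRigidity/Lines/Sketch.lean`). Lead seat c7, cycle 4 (growth item G13). The three-level duplication join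
`stub_dupJoinKernelGen` (levels `N, −N, N²`) is stacked once more: on the sector generated by all box generators
`[□ʲ, x^a/(ν − ∏x)^m]` (`j ≤ w`) at the FIVE levels `ν = N, −N, N², −N², N⁴` of an integer `N ≥ 2`, Conjecture 1 of
Kontsevich–Zagier holds in kernel form as soon as `1, Li_s(1/N), Li_s(−1/N), Li_s(−1/N²)` (`s ≤ w`) are ℚ-linearly
independent. Two elimination rounds, both by the landed weight-`i` duplication move chain `stub_dupMoveGen`
(`[□ⁱ, ε/(M² − ∏p)] ≡ 2^{i−1}[□ⁱ, ε/(M − ∏p)] + 2^{i−1}[□ⁱ, ε/((−M) − ∏p)]`): with `M = N²` the level `N⁴` is pushed to the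
levels `N², −N²`, then with `M = N` the (total) level-`N²` part is pushed to the levels `N, −N`. Values: the duplication
`Li_i(1/M²) = 2^{i−1}(Li_i(1/M) + Li_i(−1/M))` at `M = N²` and `M = N` (soundness of the chains); bookkeeping by
`two_carriers_neg`, `carrier_add` and five constants summing to zero.

References: M. Kontsevich, D. Zagier, *Periods* (2001), §1.2 [cite: KontsevichZagier2001, §1.2]; S. David, N. Hirata-Kohno,
M. Kawashima, Moscow J. Comb. Number Theory 9 (2020), Thm 2.1 [cite: DavidHirataKohnoKawashima2020, Thm 2.1]. No definitions are
introduced.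
-/

noncomputable section

open MeasureTheory Set MvPolynomial

namespace Summit.KontsevichZagierPeriods.HermiteRigidity.ReductionRigidity

open Literature.NumberTheory.Transcendental
open Literature.NumberTheory.Transcendental.KZ

/-! ## Tools -/

/-- Five carriers of one additive family whose parameters sum to `0` add up to a relation (two `carrier_add` merges and
`three_carriers_zero`). [cite: KontsevichZagier2001, §1.2 rule (1)] -/
private theorem five_carriers_zero {n : ℕ} {D : Set (Fin n → ℝ)} (f : ℚ → (Fin n → ℝ) → ℝ)
    (hf : ∀ β β' x, f (β + β') x = f β x + f β' x) (hf0 : ∀ x, f 0 x = 0)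
    (hex : ∀ β : ℚ, ∃ s : IntegralRep n, s.domain = D ∧ EqOn s.integrand (f β) D)
    {β₁ β₂ β₃ β₄ β₅ : ℚ} (hsum : β₁ + β₂ + β₃ + β₄ + β₅ = 0) {s₁ s₂ s₃ s₄ s₅ : IntegralRep n}
    (h₁ : s₁.domain = D) (h₁i : EqOn s₁.integrand (f β₁) D) (h₂ : s₂.domain = D) (h₂i : EqOn s₂.integrand (f β₂) D)
    (h₃ : s₃.domain = D) (h₃i : EqOn s₃.integrand (f β₃) D) (h₄ : s₄.domain = D) (h₄i : EqOn s₄.integrand (f β₄) D)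
    (h₅ : s₅.domain = D) (h₅i : EqOn s₅.integrand (f β₅) D) :
    KZ.of s₁ + KZ.of s₂ + KZ.of s₃ + KZ.of s₄ + KZ.of s₅ ∈ KZ.relations := by
  obtain ⟨t₁, ht₁, ht₁i⟩ := hex (β₁ + β₂)
  obtain ⟨t₂, ht₂, ht₂i⟩ := hex (β₃ + β₄)
  have e₁ := carrier_add f hf h₁ h₁i h₂ h₂i ht₁ ht₁i
  have e₂ := carrier_add f hf h₃ h₃i h₄ h₄i ht₂ ht₂i
  have e₃ : KZ.of t₁ + KZ.of t₂ + KZ.of s₅ ∈ KZ.relations :=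
    three_carriers_zero f hf hf0 hex (by linear_combination hsum) ht₁ ht₁i ht₂ ht₂i h₅ h₅i
  have : KZ.of s₁ + KZ.of s₂ + KZ.of s₃ + KZ.of s₄ + KZ.of s₅ =
      (KZ.of t₁ + KZ.of t₂ + KZ.of s₅) - (KZ.of t₁ - KZ.of s₁ - KZ.of s₂) - (KZ.of t₂ - KZ.of s₃ - KZ.of s₄) := by
    abel
  rw [this]
  exact KZ.relations.sub_mem (KZ.relations.sub_mem e₃ e₁) e₂

/-- The weight-`i+1` duplication VALUE relation `∫_□ dp/(N² − ∏p) = 2ⁱ ∫_□ dp/(N − ∏p) + 2ⁱ ∫_□ dp/((−N) − ∏p)`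
(`Li_{i+1}(1/N²) = 2ⁱ(Li_{i+1}(1/N) + Li_{i+1}(−1/N))`), by soundness of the move chain `stub_dupMoveGen`.
[cite: KontsevichZagier2001, §1.2] -/
private theorem dup_value {N : ℕ} (hN : 2 ≤ N) (i : ℕ) :
    (∫ p in cube (i + 1), 1 / ((N : ℝ) ^ 2 - ∏ l, p l)) =
      2 ^ i * (∫ p in cube (i + 1), 1 / ((N : ℝ) - ∏ l, p l)) +
        2 ^ i * (∫ p in cube (i + 1), 1 / ((-(N : ℝ)) - ∏ l, p l)) := by
  have hν₁ : (1 : ℚ) < N ∨ (N : ℚ) < 0 := natLevel hN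
  have h2Q : (2 : ℚ) ≤ N := by exact_mod_cast hN
  have hν₂ : (1 : ℚ) < (-(N : ℚ)) ∨ (-(N : ℚ)) < 0 := Or.inr (by linarith)
  have hν₃ : (1 : ℚ) < ((N : ℚ) ^ 2) ∨ ((N : ℚ) ^ 2) < 0 := Or.inl (by nlinarith)
  have c₁R : ((N : ℚ) : ℝ) = (N : ℝ) := by push_cast; ring
  have c₂R : ((-(N : ℚ) : ℚ) : ℝ) = -(N : ℝ) := by push_cast; ring
  have c₃R : ((((N : ℚ) ^ 2 : ℚ)) : ℝ) = (N : ℝ) ^ 2 := by push_cast; ring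
  obtain ⟨r, hr, hri⟩ := exists_nfRep (i := i + 1) hν₃ 1
  obtain ⟨s, hs, hsi⟩ := exists_nfRep (i := i + 1) hν₁ (2 ^ i * 1)
  obtain ⟨t, ht, hti⟩ := exists_nfRep (i := i + 1) hν₂ (2 ^ i * 1)
  have hmove : KZ.of r - KZ.of s - KZ.of t ∈ KZ.relations := by
    refine stub_dupMoveGen N hN (i + 1) (Nat.succ_pos i) 1 r s t hr (fun p hp => by rw [hri hp, c₃R])
      hs (fun p hp => ?_) ht (fun p hp => ?_)
    · rw [hsi hp, Nat.add_sub_cancel, c₁R]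
    · rw [hti hp, Nat.add_sub_cancel, c₂R]
  have e := eval_eq_zero_of_mem_relations hmove
  rw [map_sub, map_sub, eval_nfRep hr hri, eval_nfRep hs hsi, eval_nfRep ht hti, c₁R, c₂R, c₃R] at e
  have h1 : ((1 : ℚ) : ℝ) = 1 := Rat.cast_one
  have h2 : ((2 ^ i * 1 : ℚ) : ℝ) = 2 ^ i := by push_cast; ring
  rw [h1, h2] at e
  linear_combination e

/-- **The dimension-`i+1` bookkeeping of the tower**: if the total coefficients `α + 2ⁱ(γ + 2ⁱη)`, `β + 2ⁱ(γ + 2ⁱη)`,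
`δ + 2ⁱη` vanish, the five normal forms `[□, α/(N − ∏)]`, `[□, β/((−N) − ∏)]`, `[□, γ/(N² − ∏)]`, `[□, δ/((−N²) − ∏)]`,
`[□, η/(N⁴ − ∏)]` on `□ = [0,1]^{i+1}` sum to a relation: the duplication move chain `stub_dupMoveGen` at `M = N²`
(level `N⁴ ↦ N², −N²`), one `carrier_add` merge at level `N²`, the chain at `M = N` (level `N² ↦ N, −N`) and three pairs
of opposite carriers (`two_carriers_neg`). [cite: KontsevichZagier2001, §1.2 rules (1), (2)] -/
private theorem tower_dim_succ {N : ℕ} (hN : 2 ≤ N) (i : ℕ) {α β γ δ η : ℚ}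
    (hB : α + 2 ^ i * (γ + 2 ^ i * η) = 0) (hC : β + 2 ^ i * (γ + 2 ^ i * η) = 0) (hD : δ + 2 ^ i * η = 0)
    {s t u v z : IntegralRep (i + 1)}
    (hs : s.domain = cube (i + 1))
    (hsi : EqOn s.integrand (fun p => (α : ℝ) / (((N : ℚ) : ℝ) - ∏ l, p l)) (cube (i + 1)))
    (ht : t.domain = cube (i + 1))
    (hti : EqOn t.integrand (fun p => (β : ℝ) / (((-(N : ℚ) : ℚ)) - ∏ l, p l)) (cube (i + 1)))
    (hu : u.domain = cube (i + 1))
    (hui : EqOn u.integrand (fun p => (γ : ℝ) / ((((N : ℚ) ^ 2 : ℚ) : ℝ) - ∏ l, p l)) (cube (i + 1)))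
    (hv : v.domain = cube (i + 1))
    (hvi : EqOn v.integrand (fun p => (δ : ℝ) / (((-(N : ℚ) ^ 2 : ℚ) : ℝ) - ∏ l, p l)) (cube (i + 1)))
    (hz : z.domain = cube (i + 1))
    (hzi : EqOn z.integrand (fun p => (η : ℝ) / ((((N : ℚ) ^ 4 : ℚ) : ℝ) - ∏ l, p l)) (cube (i + 1))) :
    KZ.of s + KZ.of t + KZ.of u + KZ.of v + KZ.of z ∈ KZ.relations := by
  have hν₁ : (1 : ℚ) < N ∨ (N : ℚ) < 0 := natLevel hN
  have h2Q : (2 : ℚ) ≤ N := by exact_mod_cast hN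
  have hν₂ : (1 : ℚ) < (-(N : ℚ)) ∨ (-(N : ℚ)) < 0 := Or.inr (by linarith)
  have hν₃ : (1 : ℚ) < ((N : ℚ) ^ 2) ∨ ((N : ℚ) ^ 2) < 0 := Or.inl (by nlinarith)
  have hν₄ : (1 : ℚ) < (-(N : ℚ) ^ 2) ∨ (-(N : ℚ) ^ 2) < 0 := Or.inr (neg_lt_zero.2 (pow_pos (by linarith) 2))
  have hN2 : 2 ≤ N ^ 2 := le_trans hN (Nat.le_self_pow two_ne_zero N)
  have c₁R : ((N : ℚ) : ℝ) = (N : ℝ) := by push_cast; ring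
  have c₂R : ((-(N : ℚ) : ℚ) : ℝ) = -(N : ℝ) := by push_cast; ring
  have c₃R : ((((N : ℚ) ^ 2 : ℚ)) : ℝ) = (N : ℝ) ^ 2 := by push_cast; ring
  have c₃R' : ((((N : ℚ) ^ 2 : ℚ)) : ℝ) = ((N ^ 2 : ℕ) : ℝ) := by push_cast; ring
  have c₄R' : (((-(N : ℚ) ^ 2 : ℚ)) : ℝ) = -((N ^ 2 : ℕ) : ℝ) := by push_cast; ring
  have c₅R' : ((((N : ℚ) ^ 4 : ℚ)) : ℝ) = ((N ^ 2 : ℕ) : ℝ) ^ 2 := by push_cast; ring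
  -- round 1: the duplication chain at `M = N²` pushes the level `N⁴` to the levels `N², −N²`
  obtain ⟨uP, huP, huPi⟩ := exists_nfRep (i := i + 1) hν₃ (2 ^ i * η)
  obtain ⟨vP, hvP, hvPi⟩ := exists_nfRep (i := i + 1) hν₄ (2 ^ i * η)
  have hmove₁ : KZ.of z - KZ.of uP - KZ.of vP ∈ KZ.relations := by
    refine stub_dupMoveGen (N ^ 2) hN2 (i + 1) (Nat.succ_pos i) η z uP vP hz (fun p hp => by rw [hzi hp, c₅R'])
      huP (fun p hp => ?_) hvP (fun p hp => ?_)
    · rw [huPi hp, Nat.add_sub_cancel, c₃R']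
    · rw [hvPi hp, Nat.add_sub_cancel, c₄R']
  -- merge the two level-`N²` carriers
  obtain ⟨U, hU, hUi⟩ := exists_nfRep (i := i + 1) hν₃ (γ + 2 ^ i * η)
  have hmerge : KZ.of U - KZ.of u - KZ.of uP ∈ KZ.relations :=
    carrier_add (D := cube (i + 1)) (fun b p => (b : ℝ) / ((((N : ℚ) ^ 2 : ℚ) : ℝ) - ∏ l, p l))
      (fun b b' p => by push_cast; ring) (β := γ) (β' := 2 ^ i * η) hu hui huP huPi hU hUi
  -- round 2: the duplication chain at `M = N` pushes the level `N²` to the levels `N, −N`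
  obtain ⟨sP, hsP, hsPi⟩ := exists_nfRep (i := i + 1) hν₁ (2 ^ i * (γ + 2 ^ i * η))
  obtain ⟨tP, htP, htPi⟩ := exists_nfRep (i := i + 1) hν₂ (2 ^ i * (γ + 2 ^ i * η))
  have hmove₂ : KZ.of U - KZ.of sP - KZ.of tP ∈ KZ.relations := by
    refine stub_dupMoveGen N hN (i + 1) (Nat.succ_pos i) (γ + 2 ^ i * η) U sP tP hU (fun p hp => by rw [hUi hp, c₃R])
      hsP (fun p hp => ?_) htP (fun p hp => ?_)
    · rw [hsPi hp, Nat.add_sub_cancel, c₁R]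
    · rw [htPi hp, Nat.add_sub_cancel, c₂R]
  -- three pairs of opposite carriers
  have hα : α = -(2 ^ i * (γ + 2 ^ i * η)) := by linear_combination hB
  have hβ : β = -(2 ^ i * (γ + 2 ^ i * η)) := by linear_combination hC
  have hδ : δ = -(2 ^ i * η) := by linear_combination hD
  subst hα hβ hδ
  have es : KZ.of sP + KZ.of s ∈ KZ.relations :=
    two_carriers_neg (D := cube (i + 1)) (fun b p => (b : ℝ) / (((N : ℚ) : ℝ) - ∏ l, p l))
      (fun b b' p => by push_cast; ring) (fun p => by simp) (fun b => exists_nfRep (i := i + 1) hν₁ b)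
      (β := 2 ^ i * (γ + 2 ^ i * η)) hsP hsPi hs hsi
  have et : KZ.of tP + KZ.of t ∈ KZ.relations :=
    two_carriers_neg (D := cube (i + 1)) (fun b p => (b : ℝ) / (((-(N : ℚ) : ℚ)) - ∏ l, p l))
      (fun b b' p => by push_cast; ring) (fun p => by simp) (fun b => exists_nfRep (i := i + 1) hν₂ b)
      (β := 2 ^ i * (γ + 2 ^ i * η)) htP htPi ht hti
  have ev : KZ.of vP + KZ.of v ∈ KZ.relations :=
    two_carriers_neg (D := cube (i + 1)) (fun b p => (b : ℝ) / (((-(N : ℚ) ^ 2 : ℚ)) - ∏ l, p l))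
      (fun b b' p => by push_cast; ring) (fun p => by simp) (fun b => exists_nfRep (i := i + 1) hν₄ b)
      (β := 2 ^ i * η) hvP hvPi hv hvi
  have : KZ.of s + KZ.of t + KZ.of u + KZ.of v + KZ.of z =
      (KZ.of z - KZ.of uP - KZ.of vP) + (KZ.of vP + KZ.of v) - (KZ.of U - KZ.of u - KZ.of uP) +
        (KZ.of U - KZ.of sP - KZ.of tP) + (KZ.of sP + KZ.of s) + (KZ.of tP + KZ.of t) := by
    abel
  rw [this]
  exact KZ.relations.add_mem (KZ.relations.add_mem (KZ.relations.add_mem (KZ.relations.sub_mem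
    (KZ.relations.add_mem hmove₁ ev) hmerge) hmove₂) es) et

/-! ## The assembly -/

/-- **Stub `stub_dupTowerTwoKernelGen`** (sub-goal of crux `ReductionRigidity`, stmt-3407, line `Sketch`, lead c7 cycle 4,
growth G13): **the duplication tower of height two, rigidity inlined.** For integers `w` and `N ≥ 2`: IF the `3w + 1`
numbers `1, ∫_□ⁱ dp/(N − ∏p), ∫_□ⁱ dp/((−N) − ∏p), ∫_□ⁱ dp/((−N²) − ∏p)` (`1 ≤ i ≤ w`;
`= 1, Li_i(1/N), Li_i(−1/N), Li_i(−1/N²)`) are ℚ-linearly independent, THEN Conjecture 1 of Kontsevich–Zagier holds in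
kernel form on the sector generated by ALL box generators `[□ʲ, x^a/(ν − ∏x)^m]`, `j ≤ w`, at the FIVE levels `ν = N`,
`ν = −N`, `ν = N²`, `ν = −N²`, `ν = N⁴`: every `ℤ`-combination of value `0` is a chain of moves. Reductions:
`levelNormalForm` at each level; the level `N⁴` is pushed to `N², −N²` by the duplication chains `stub_dupMoveGen` at
`M = N²`, the level `N²` to `N, −N` by the chains at `M = N` (each chain used twice: soundness ⇒ the value relation
`Li_i(1/M²) = 2^{i−1}(Li_i(1/M) + Li_i(−1/M))`; the move itself ⇒ kills the part), and the five constants are one relation.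
[cite: KontsevichZagier2001, §1.2] [cite: DavidHirataKohnoKawashima2020, Thm 2.1] -/
theorem stub_dupTowerTwoKernelGen : ∀ (w N : ℕ), 2 ≤ N →
    (∀ (a : ℚ) (b c d : ℕ → ℚ),
      (a : ℝ) + ∑ i ∈ Finset.range w, (b i : ℝ) * (∫ p in cube (i + 1), 1 / ((N : ℝ) - ∏ l, p l)) +
          ∑ i ∈ Finset.range w, (c i : ℝ) * (∫ p in cube (i + 1), 1 / ((-(N : ℝ)) - ∏ l, p l)) +
          ∑ i ∈ Finset.range w, (d i : ℝ) * (∫ p in cube (i + 1), 1 / ((-((N : ℝ) ^ 2)) - ∏ l, p l)) = 0 →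
        a = 0 ∧ (∀ i ∈ Finset.range w, b i = 0) ∧ (∀ i ∈ Finset.range w, c i = 0) ∧ (∀ i ∈ Finset.range w, d i = 0)) →
    ∀ c ∈ AddSubgroup.closure
      ({c | ∃ (j : ℕ) (r : IntegralRep j) (a : Fin j → ℕ) (m : ℕ), j ≤ w ∧ r.domain = cube j ∧
          EqOn r.integrand (fun p => (∏ l, p l ^ a l) / ((N : ℝ) - ∏ l, p l) ^ m) (cube j) ∧ c = KZ.of r} ∪
        {c | ∃ (j : ℕ) (r : IntegralRep j) (a : Fin j → ℕ) (m : ℕ), j ≤ w ∧ r.domain = cube j ∧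
          EqOn r.integrand (fun p => (∏ l, p l ^ a l) / ((-(N : ℝ)) - ∏ l, p l) ^ m) (cube j) ∧ c = KZ.of r} ∪
        {c | ∃ (j : ℕ) (r : IntegralRep j) (a : Fin j → ℕ) (m : ℕ), j ≤ w ∧ r.domain = cube j ∧
          EqOn r.integrand (fun p => (∏ l, p l ^ a l) / ((N : ℝ) ^ 2 - ∏ l, p l) ^ m) (cube j) ∧ c = KZ.of r} ∪
        {c | ∃ (j : ℕ) (r : IntegralRep j) (a : Fin j → ℕ) (m : ℕ), j ≤ w ∧ r.domain = cube j ∧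
          EqOn r.integrand (fun p => (∏ l, p l ^ a l) / ((-((N : ℝ) ^ 2)) - ∏ l, p l) ^ m) (cube j) ∧ c = KZ.of r} ∪
        {c | ∃ (j : ℕ) (r : IntegralRep j) (a : Fin j → ℕ) (m : ℕ), j ≤ w ∧ r.domain = cube j ∧
          EqOn r.integrand (fun p => (∏ l, p l ^ a l) / ((N : ℝ) ^ 4 - ∏ l, p l) ^ m) (cube j) ∧ c = KZ.of r}),
      KZ.eval c = 0 → c ∈ KZ.relations := by
  intro w N hN hrig c hc h0
  have hν₁ : (1 : ℚ) < N ∨ (N : ℚ) < 0 := natLevel hN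
  have h2Q : (2 : ℚ) ≤ N := by exact_mod_cast hN
  have hν₂ : (1 : ℚ) < (-(N : ℚ)) ∨ (-(N : ℚ)) < 0 := Or.inr (by linarith)
  have hν₃ : (1 : ℚ) < ((N : ℚ) ^ 2) ∨ ((N : ℚ) ^ 2) < 0 := Or.inl (by nlinarith)
  have hν₄ : (1 : ℚ) < (-(N : ℚ) ^ 2) ∨ (-(N : ℚ) ^ 2) < 0 := Or.inr (neg_lt_zero.2 (pow_pos (by linarith) 2))
  have hν₅ : (1 : ℚ) < ((N : ℚ) ^ 4) ∨ ((N : ℚ) ^ 4) < 0 := Or.inl (one_lt_pow₀ (by linarith) four_ne_zero)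
  have hN2 : 2 ≤ N ^ 2 := le_trans hN (Nat.le_self_pow two_ne_zero N)
  have c₁R : ((N : ℚ) : ℝ) = (N : ℝ) := by push_cast; ring
  have c₂R : ((-(N : ℚ) : ℚ) : ℝ) = -(N : ℝ) := by push_cast; ring
  have c₃R : ((((N : ℚ) ^ 2 : ℚ)) : ℝ) = (N : ℝ) ^ 2 := by push_cast; ring
  have c₄R : (((-(N : ℚ) ^ 2 : ℚ)) : ℝ) = -((N : ℝ) ^ 2) := by push_cast; ring
  have c₅R : ((((N : ℚ) ^ 4 : ℚ)) : ℝ) = (N : ℝ) ^ 4 := by push_cast; ring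
  -- split `c` along the five levels and take normal forms
  rw [AddSubgroup.closure_union, AddSubgroup.closure_union, AddSubgroup.closure_union, AddSubgroup.closure_union] at hc
  obtain ⟨x₁₂₃₄, hx₁₂₃₄, x₅, hx₅, rfl⟩ := AddSubgroup.mem_sup.1 hc
  obtain ⟨x₁₂₃, hx₁₂₃, x₄, hx₄, rfl⟩ := AddSubgroup.mem_sup.1 hx₁₂₃₄
  obtain ⟨x₁₂, hx₁₂, x₃, hx₃, rfl⟩ := AddSubgroup.mem_sup.1 hx₁₂₃
  obtain ⟨x₁, hx₁, x₂, hx₂, rfl⟩ := AddSubgroup.mem_sup.1 hx₁₂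
  obtain ⟨α, s, hs, hx₁s⟩ := levelNormalForm hν₁ w x₁ (by
    refine AddSubgroup.closure_mono (fun c hc => ?_) hx₁
    obtain ⟨j, r, a, m, hj, hr, hri, rfl⟩ := hc
    exact ⟨j, r, a, m, hj, hr, fun p hp => by rw [hri hp, c₁R], rfl⟩)
  obtain ⟨β, t, ht, hx₂t⟩ := levelNormalForm hν₂ w x₂ (by
    refine AddSubgroup.closure_mono (fun c hc => ?_) hx₂
    obtain ⟨j, r, a, m, hj, hr, hri, rfl⟩ := hc
    exact ⟨j, r, a, m, hj, hr, fun p hp => by rw [hri hp, c₂R], rfl⟩)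
  obtain ⟨γ, u, hu, hx₃u⟩ := levelNormalForm hν₃ w x₃ (by
    refine AddSubgroup.closure_mono (fun c hc => ?_) hx₃
    obtain ⟨j, r, a, m, hj, hr, hri, rfl⟩ := hc
    exact ⟨j, r, a, m, hj, hr, fun p hp => by rw [hri hp, c₃R], rfl⟩)
  obtain ⟨δ, v, hv, hx₄v⟩ := levelNormalForm hν₄ w x₄ (by
    refine AddSubgroup.closure_mono (fun c hc => ?_) hx₄
    obtain ⟨j, r, a, m, hj, hr, hri, rfl⟩ := hc
    exact ⟨j, r, a, m, hj, hr, fun p hp => by rw [hri hp, c₄R], rfl⟩)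
  obtain ⟨η, z, hz, hx₅z⟩ := levelNormalForm hν₅ w x₅ (by
    refine AddSubgroup.closure_mono (fun c hc => ?_) hx₅
    obtain ⟨j, r, a, m, hj, hr, hri, rfl⟩ := hc
    exact ⟨j, r, a, m, hj, hr, fun p hp => by rw [hri hp, c₅R], rfl⟩)
  -- VALUES
  set I : ℕ → ℝ → ℝ := fun i ν => ∫ p in cube i, 1 / (ν - ∏ l, p l) with hI
  have I0 : ∀ ν : ℚ, (∫ p in cube 0, 1 / ((ν : ℝ) - ∏ l, p l)) = 1 / ((ν : ℝ) - 1) := integral_cube_zero_level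
  have evx₁ : KZ.eval x₁ = ∑ i ∈ Finset.range (w + 1), (α i : ℝ) * I i N := by
    have e := eval_eq_zero_of_mem_relations hx₁s
    rw [map_sub, map_sum, sub_eq_zero] at e; rw [e]
    refine Finset.sum_congr rfl fun i _ => ?_
    rw [eval_nfRep (hs i).1 (hs i).2, c₁R]
  have evx₂ : KZ.eval x₂ = ∑ i ∈ Finset.range (w + 1), (β i : ℝ) * I i (-(N : ℝ)) := by
    have e := eval_eq_zero_of_mem_relations hx₂t
    rw [map_sub, map_sum, sub_eq_zero] at e; rw [e]
    refine Finset.sum_congr rfl fun i _ => ?_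
    rw [eval_nfRep (ht i).1 (ht i).2, c₂R]
  have evx₃ : KZ.eval x₃ = ∑ i ∈ Finset.range (w + 1), (γ i : ℝ) * I i ((N : ℝ) ^ 2) := by
    have e := eval_eq_zero_of_mem_relations hx₃u
    rw [map_sub, map_sum, sub_eq_zero] at e; rw [e]
    refine Finset.sum_congr rfl fun i _ => ?_
    rw [eval_nfRep (hu i).1 (hu i).2, c₃R]
  have evx₄ : KZ.eval x₄ = ∑ i ∈ Finset.range (w + 1), (δ i : ℝ) * I i (-((N : ℝ) ^ 2)) := by
    have e := eval_eq_zero_of_mem_relations hx₄v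
    rw [map_sub, map_sum, sub_eq_zero] at e; rw [e]
    refine Finset.sum_congr rfl fun i _ => ?_
    rw [eval_nfRep (hv i).1 (hv i).2, c₄R]
  have evx₅ : KZ.eval x₅ = ∑ i ∈ Finset.range (w + 1), (η i : ℝ) * I i ((N : ℝ) ^ 4) := by
    have e := eval_eq_zero_of_mem_relations hx₅z
    rw [map_sub, map_sum, sub_eq_zero] at e; rw [e]
    refine Finset.sum_congr rfl fun i _ => ?_
    rw [eval_nfRep (hz i).1 (hz i).2, c₅R]
  -- split off the constants `i = 0`
  have evx₁' : KZ.eval x₁ = (α 0 : ℝ) * (1 / ((N : ℝ) - 1)) + ∑ i ∈ Finset.range w, (α (i + 1) : ℝ) * I (i + 1) N := by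
    rw [evx₁, Finset.sum_range_succ', add_comm]
    congr 1; simp only [hI]
    rw [← c₁R, I0]
  have evx₂' : KZ.eval x₂ = (β 0 : ℝ) * (1 / (-(N : ℝ) - 1)) +
      ∑ i ∈ Finset.range w, (β (i + 1) : ℝ) * I (i + 1) (-(N : ℝ)) := by
    rw [evx₂, Finset.sum_range_succ', add_comm]
    congr 1; simp only [hI]
    rw [← c₂R, I0]
  have evx₃' : KZ.eval x₃ = (γ 0 : ℝ) * (1 / ((N : ℝ) ^ 2 - 1)) +
      ∑ i ∈ Finset.range w, (γ (i + 1) : ℝ) * I (i + 1) ((N : ℝ) ^ 2) := by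
    rw [evx₃, Finset.sum_range_succ', add_comm]
    congr 1; simp only [hI]
    rw [← c₃R, I0]
  have evx₄' : KZ.eval x₄ = (δ 0 : ℝ) * (1 / (-((N : ℝ) ^ 2) - 1)) +
      ∑ i ∈ Finset.range w, (δ (i + 1) : ℝ) * I (i + 1) (-((N : ℝ) ^ 2)) := by
    rw [evx₄, Finset.sum_range_succ', add_comm]
    congr 1; simp only [hI]
    rw [← c₄R, I0]
  have evx₅' : KZ.eval x₅ = (η 0 : ℝ) * (1 / ((N : ℝ) ^ 4 - 1)) +
      ∑ i ∈ Finset.range w, (η (i + 1) : ℝ) * I (i + 1) ((N : ℝ) ^ 4) := by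
    rw [evx₅, Finset.sum_range_succ', add_comm]
    congr 1; simp only [hI]
    rw [← c₅R, I0]
  -- the duplication VALUE relations at `M = N²` and `M = N`, summed
  have hN2R : ((N ^ 2 : ℕ) : ℝ) = (N : ℝ) ^ 2 := by push_cast; ring
  have hN4R : ((N : ℝ) ^ 2) ^ 2 = (N : ℝ) ^ 4 := by ring
  have hdup₁ : ∀ i, I (i + 1) ((N : ℝ) ^ 4) =
      2 ^ i * I (i + 1) ((N : ℝ) ^ 2) + 2 ^ i * I (i + 1) (-((N : ℝ) ^ 2)) := by
    intro i
    have h := dup_value hN2 i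
    rw [hN2R, hN4R] at h
    exact h
  have hdup₂ : ∀ i, I (i + 1) ((N : ℝ) ^ 2) = 2 ^ i * I (i + 1) (N : ℝ) + 2 ^ i * I (i + 1) (-(N : ℝ)) :=
    fun i => dup_value hN i
  have hdup₁Sum : ∑ i ∈ Finset.range w, (η (i + 1) : ℝ) * I (i + 1) ((N : ℝ) ^ 4) =
      ∑ i ∈ Finset.range w, ((2 ^ i * η (i + 1) : ℚ) : ℝ) * I (i + 1) ((N : ℝ) ^ 2) +
        ∑ i ∈ Finset.range w, ((2 ^ i * η (i + 1) : ℚ) : ℝ) * I (i + 1) (-((N : ℝ) ^ 2)) := by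
    rw [← Finset.sum_add_distrib]
    exact Finset.sum_congr rfl fun i _ => by rw [hdup₁ i]; push_cast; ring
  have hdup₂Sum : ∑ i ∈ Finset.range w, ((γ (i + 1) + 2 ^ i * η (i + 1) : ℚ) : ℝ) * I (i + 1) ((N : ℝ) ^ 2) =
      ∑ i ∈ Finset.range w, ((2 ^ i * (γ (i + 1) + 2 ^ i * η (i + 1)) : ℚ) : ℝ) * I (i + 1) N +
        ∑ i ∈ Finset.range w, ((2 ^ i * (γ (i + 1) + 2 ^ i * η (i + 1)) : ℚ) : ℝ) * I (i + 1) (-(N : ℝ)) := by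
    rw [← Finset.sum_add_distrib]
    exact Finset.sum_congr rfl fun i _ => by rw [hdup₂ i]; push_cast; ring
  have hG : ∑ i ∈ Finset.range w, ((γ (i + 1) + 2 ^ i * η (i + 1) : ℚ) : ℝ) * I (i + 1) ((N : ℝ) ^ 2) =
      ∑ i ∈ Finset.range w, (γ (i + 1) : ℝ) * I (i + 1) ((N : ℝ) ^ 2) +
        ∑ i ∈ Finset.range w, ((2 ^ i * η (i + 1) : ℚ) : ℝ) * I (i + 1) ((N : ℝ) ^ 2) := by
    rw [← Finset.sum_add_distrib]
    exact Finset.sum_congr rfl fun i _ => by push_cast; ring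
  -- the value of `c`, in the shape of the rigidity hypothesis
  have h0' : KZ.eval x₁ + KZ.eval x₂ + KZ.eval x₃ + KZ.eval x₄ + KZ.eval x₅ = 0 := by
    rwa [map_add, map_add, map_add, map_add] at h0
  have hB : ∑ i ∈ Finset.range w, ((α (i + 1) + 2 ^ i * (γ (i + 1) + 2 ^ i * η (i + 1)) : ℚ) : ℝ) * I (i + 1) N =
      ∑ i ∈ Finset.range w, (α (i + 1) : ℝ) * I (i + 1) N +
        ∑ i ∈ Finset.range w, ((2 ^ i * (γ (i + 1) + 2 ^ i * η (i + 1)) : ℚ) : ℝ) * I (i + 1) N := by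
    rw [← Finset.sum_add_distrib]
    exact Finset.sum_congr rfl fun i _ => by push_cast; ring
  have hC : ∑ i ∈ Finset.range w, ((β (i + 1) + 2 ^ i * (γ (i + 1) + 2 ^ i * η (i + 1)) : ℚ) : ℝ) * I (i + 1) (-(N : ℝ)) =
      ∑ i ∈ Finset.range w, (β (i + 1) : ℝ) * I (i + 1) (-(N : ℝ)) +
        ∑ i ∈ Finset.range w, ((2 ^ i * (γ (i + 1) + 2 ^ i * η (i + 1)) : ℚ) : ℝ) * I (i + 1) (-(N : ℝ)) := by
    rw [← Finset.sum_add_distrib]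
    exact Finset.sum_congr rfl fun i _ => by push_cast; ring
  have hD : ∑ i ∈ Finset.range w, ((δ (i + 1) + 2 ^ i * η (i + 1) : ℚ) : ℝ) * I (i + 1) (-((N : ℝ) ^ 2)) =
      ∑ i ∈ Finset.range w, (δ (i + 1) : ℝ) * I (i + 1) (-((N : ℝ) ^ 2)) +
        ∑ i ∈ Finset.range w, ((2 ^ i * η (i + 1) : ℚ) : ℝ) * I (i + 1) (-((N : ℝ) ^ 2)) := by
    rw [← Finset.sum_add_distrib]
    exact Finset.sum_congr rfl fun i _ => by push_cast; ring
  have hval : ((α 0 / ((N : ℚ) - 1) + β 0 / (-(N : ℚ) - 1) + γ 0 / ((N : ℚ) ^ 2 - 1) +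
        δ 0 / (-(N : ℚ) ^ 2 - 1) + η 0 / ((N : ℚ) ^ 4 - 1) : ℚ) : ℝ) +
      ∑ i ∈ Finset.range w, ((α (i + 1) + 2 ^ i * (γ (i + 1) + 2 ^ i * η (i + 1)) : ℚ) : ℝ) *
        (∫ p in cube (i + 1), 1 / ((N : ℝ) - ∏ l, p l)) +
      ∑ i ∈ Finset.range w, ((β (i + 1) + 2 ^ i * (γ (i + 1) + 2 ^ i * η (i + 1)) : ℚ) : ℝ) *
        (∫ p in cube (i + 1), 1 / ((-(N : ℝ)) - ∏ l, p l)) +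
      ∑ i ∈ Finset.range w, ((δ (i + 1) + 2 ^ i * η (i + 1) : ℚ) : ℝ) *
        (∫ p in cube (i + 1), 1 / ((-((N : ℝ) ^ 2)) - ∏ l, p l)) = 0 := by
    have eB : ∑ i ∈ Finset.range w, ((α (i + 1) + 2 ^ i * (γ (i + 1) + 2 ^ i * η (i + 1)) : ℚ) : ℝ) *
        (∫ p in cube (i + 1), 1 / ((N : ℝ) - ∏ l, p l)) =
        ∑ i ∈ Finset.range w, ((α (i + 1) + 2 ^ i * (γ (i + 1) + 2 ^ i * η (i + 1)) : ℚ) : ℝ) * I (i + 1) N := by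
      simp only [hI]
    have eC : ∑ i ∈ Finset.range w, ((β (i + 1) + 2 ^ i * (γ (i + 1) + 2 ^ i * η (i + 1)) : ℚ) : ℝ) *
        (∫ p in cube (i + 1), 1 / ((-(N : ℝ)) - ∏ l, p l)) =
        ∑ i ∈ Finset.range w, ((β (i + 1) + 2 ^ i * (γ (i + 1) + 2 ^ i * η (i + 1)) : ℚ) : ℝ) *
          I (i + 1) (-(N : ℝ)) := by
      simp only [hI]
    have eD : ∑ i ∈ Finset.range w, ((δ (i + 1) + 2 ^ i * η (i + 1) : ℚ) : ℝ) *
        (∫ p in cube (i + 1), 1 / ((-((N : ℝ) ^ 2)) - ∏ l, p l)) =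
        ∑ i ∈ Finset.range w, ((δ (i + 1) + 2 ^ i * η (i + 1) : ℚ) : ℝ) * I (i + 1) (-((N : ℝ) ^ 2)) := by
      simp only [hI]
    rw [eB, eC, eD, hB, hC, hD]
    push_cast at hdup₁Sum hdup₂Sum hG ⊢
    linear_combination h0' - evx₁' - evx₂' - evx₃' - evx₄' - evx₅' - hdup₁Sum + hG - hdup₂Sum
  obtain ⟨hA, hBi, hCi, hDi⟩ := hrig _ (fun i => α (i + 1) + 2 ^ i * (γ (i + 1) + 2 ^ i * η (i + 1)))
    (fun i => β (i + 1) + 2 ^ i * (γ (i + 1) + 2 ^ i * η (i + 1))) (fun i => δ (i + 1) + 2 ^ i * η (i + 1)) hval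
  -- RELATIONS: dimension `i + 1`
  have hS : ∀ i ∈ Finset.range w,
      KZ.of (s (i + 1)) + KZ.of (t (i + 1)) + KZ.of (u (i + 1)) + KZ.of (v (i + 1)) + KZ.of (z (i + 1)) ∈
        KZ.relations :=
    fun i hi => tower_dim_succ hN i (α := α (i + 1)) (β := β (i + 1)) (γ := γ (i + 1)) (δ := δ (i + 1))
      (η := η (i + 1)) (hBi i hi) (hCi i hi) (hDi i hi) (hs (i + 1)).1 (hs (i + 1)).2 (ht (i + 1)).1 (ht (i + 1)).2
      (hu (i + 1)).1 (hu (i + 1)).2 (hv (i + 1)).1 (hv (i + 1)).2 (hz (i + 1)).1 (hz (i + 1)).2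
  -- dimension zero: five constants summing to `0`
  have hZ : KZ.of (s 0) + KZ.of (t 0) + KZ.of (u 0) + KZ.of (v 0) + KZ.of (z 0) ∈ KZ.relations := by
    refine five_carriers_zero (D := cube 0) (fun b _ => (b : ℝ)) (fun b b' p => by push_cast; ring)
      (fun p => by simp) (fun b => exists_nf0 b) (β₁ := α 0 / ((N : ℚ) - 1)) (β₂ := β 0 / (-(N : ℚ) - 1))
      (β₃ := γ 0 / ((N : ℚ) ^ 2 - 1)) (β₄ := δ 0 / (-(N : ℚ) ^ 2 - 1)) (β₅ := η 0 / ((N : ℚ) ^ 4 - 1)) hA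
      (hs 0).1 (fun p hp => ?_) (ht 0).1 (fun p hp => ?_) (hu 0).1 (fun p hp => ?_) (hv 0).1 (fun p hp => ?_)
      (hz 0).1 (fun p hp => ?_)
    · rw [(hs 0).2 hp]; simp [Finset.univ_eq_empty]
    · rw [(ht 0).2 hp]; simp [Finset.univ_eq_empty]
    · rw [(hu 0).2 hp]; simp [Finset.univ_eq_empty]
    · rw [(hv 0).2 hp]; simp [Finset.univ_eq_empty]
    · rw [(hz 0).2 hp]; simp [Finset.univ_eq_empty]
  -- all dimensions together
  have hAll : ∑ i ∈ Finset.range (w + 1),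
      (KZ.of (s i) + KZ.of (t i) + KZ.of (u i) + KZ.of (v i) + KZ.of (z i)) ∈ KZ.relations := by
    rw [Finset.sum_range_succ']
    exact KZ.relations.add_mem (KZ.relations.sum_mem fun i hi => hS i hi) hZ
  have : x₁ + x₂ + x₃ + x₄ + x₅ =
      (x₁ - ∑ i ∈ Finset.range (w + 1), KZ.of (s i)) + (x₂ - ∑ i ∈ Finset.range (w + 1), KZ.of (t i)) +
        (x₃ - ∑ i ∈ Finset.range (w + 1), KZ.of (u i)) + (x₄ - ∑ i ∈ Finset.range (w + 1), KZ.of (v i)) +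
        (x₅ - ∑ i ∈ Finset.range (w + 1), KZ.of (z i)) +
        ∑ i ∈ Finset.range (w + 1), (KZ.of (s i) + KZ.of (t i) + KZ.of (u i) + KZ.of (v i) + KZ.of (z i)) := by
    rw [Finset.sum_add_distrib, Finset.sum_add_distrib, Finset.sum_add_distrib, Finset.sum_add_distrib]
    abel
  rw [this]
  exact KZ.relations.add_mem (KZ.relations.add_mem (KZ.relations.add_mem (KZ.relations.add_mem
    (KZ.relations.add_mem hx₁s hx₂t) hx₃u) hx₄v) hx₅z) hAll

end Summit.KontsevichZagierPeriods.HermiteRigidity.ReductionRigidity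

end
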